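import Mathlib
import HarnessLib
import Summits.NavierStokesRegularity.FluidComputer.BandSupCeiling
import Summits.NavierStokesRegularity.FluidComputer.BandModeCounts

/-!
# The band sup ceiling on the cell's lattice shells: `|u_B(x)|² ≤ (4/3)·M·E_B` with the certified `M`,
# and the bands as printed (`a ≤ |k| < b`)

Cell `pub-fluidc` (FLUID COMPUTER; host summit `NavierStokesRegularity`, negation side, machine paradigm),
prover seat p1 gen 14 (2026-08-26). HONEST FRAMING (verbatim): *low prior, high value-of-information
experiment on Tao's machine paradigm; NOT a claim that NS blows up.* Nothing in this file concerns the
Navier–Stokes or Euler evolution.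

Companion of `BandModeCounts` (the shells `shellIn` … `shellOut3i` of `ℤ³` and their mode counts
`308 / 96 / 2484 / 17408 / 20164 / 129788`). Here:

* `mem_shellIn_iff_sqrt`, `mem_shellOut_iff_sqrt`, `mem_shellOut2i_iff_sqrt`, `mem_shellOut3i_iff_sqrt` —
  the bands AS PRINTED by the readers, `a ≤ |k| < b` with `|k| = √(knormSq k)`: for integer `|k|²`,
  `2.5 ≤ |k| < 4.5 ⟺ 7 ≤ |k|² < 21` and `a ≤ |k| < b ⟺ a² ≤ |k|² < b²` for natural `a, b`;
  `shells_disjoint`;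
* `shell_ne_zero`, `flipAt_mem_shell`, `swapAt_mem_shell` — the three hypotheses of
  `BandSupCeiling.field_real_normSq_le` hold on every shell with `lo ≥ 1`, hence `ceiling_shell` and the
  NUMERIC ceilings `ceiling_in / ceiling_out / ceiling_out2i / ceiling_out3i`:
  `Σ_j u_{B,j}(x)² ≤ (4/3)·308·E_in`, `(4/3)·2484·E_out`, `(4/3)·17408·E_out2i`, `(4/3)·129788·E_out3i`
  for a real incompressible Fourier velocity — the kinematic ceilings behind the coherence column
  `φ = U/√((4/3) M E) ∈ [0, 1]` of `CoherenceLedger` / the deposit `atlas/rung-next/p1/coherence-time/`;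
* `coherenceSq_le_one` — under the ceiling, `φ² = (U/√(2E))²·3/(2M) ≤ 1` (the normalisation used by
  `CoherenceLedger.q2_mode_normalised`), and `ledger_phi_values` (record arithmetic).

Elementary; no named facts (D-0026).
-/

namespace Summit.NavierStokesRegularity.FluidComputer.BandModeCounts

open Finset
open Literature.Analysis.FluidPDE.FluidComputer Literature.Analysis.FluidPDE.FluidComputer.ShellTransfer
open Summit.NavierStokesRegularity.FluidComputer.BandSupCeiling
open scoped BigOperators

/-! ## 1. Real thresholds: the bands as printed (`a ≤ |k| < b`) -/

/-- For an integer `n`, `2.5 ≤ √n < 4.5 ⟺ 7 ≤ n < 21`. -/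
theorem sqrt_mem_Ico_iff_in (n : ℤ) :
    ((2.5 : ℝ) ≤ Real.sqrt n ∧ Real.sqrt n < 4.5) ↔ (7 ≤ n ∧ n < 21) := by
  rw [Real.le_sqrt' (by norm_num), Real.sqrt_lt' (by norm_num)]
  constructor
  · rintro ⟨h1, h2⟩
    norm_num at h1 h2
    have h3 : (6 : ℝ) < n := by linarith
    have h4 : (n : ℝ) < 21 := by linarith
    have h3' : (6 : ℤ) < n := by exact_mod_cast h3
    have h4' : n < (21 : ℤ) := by exact_mod_cast h4
    omega
  · rintro ⟨h1, h2⟩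
    have h3 : (7 : ℝ) ≤ n := by exact_mod_cast h1
    have h4 : (n : ℝ) ≤ 20 := by exact_mod_cast (by omega : n ≤ 20)
    norm_num
    constructor <;> linarith

/-- For an integer `n` and natural numbers `a < b`: `a ≤ √n < b ⟺ a² ≤ n < b²`. -/
theorem sqrt_mem_Ico_iff (n : ℤ) {a b : ℕ} (ha : 0 < a) :
    ((a : ℝ) ≤ Real.sqrt n ∧ Real.sqrt n < b) ↔ ((a : ℤ) ^ 2 ≤ n ∧ n < (b : ℤ) ^ 2) := by
  have ha' : (0 : ℝ) < a := by exact_mod_cast ha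
  rw [Real.le_sqrt' ha']
  constructor
  · rintro ⟨h1, h2⟩
    have hb : (0 : ℝ) < b := lt_of_le_of_lt (Real.sqrt_nonneg _) h2
    rw [Real.sqrt_lt' hb] at h2
    exact ⟨by exact_mod_cast h1, by exact_mod_cast h2⟩
  · rintro ⟨h1, h2⟩
    have hb2 : (0 : ℤ) < (b : ℤ) ^ 2 := by have := sq_nonneg (a : ℤ); linarith
    have hb : 0 < b := by
      rcases Nat.eq_zero_or_pos b with rfl | hb
      · simp at hb2
      · exact hb
    have hb' : (0 : ℝ) < b := by exact_mod_cast hb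
    refine ⟨by exact_mod_cast h1, ?_⟩
    rw [Real.sqrt_lt' hb']
    exact_mod_cast h2

/-- THE IN-BAND AS PRINTED: `k ∈ shellIn ⟺ 2.5 ≤ |k| < 4.5` with `|k| = √(knormSq k)`. -/
theorem mem_shellIn_iff_sqrt (k : Fin 3 → ℤ) :
    k ∈ shellIn ↔ (2.5 : ℝ) ≤ Real.sqrt (knormSq k) ∧ Real.sqrt (knormSq k) < 4.5 := by
  rw [knormSq_eq_cast, sqrt_mem_Ico_iff_in, shellIn, mem_shell_iff (by norm_num)]
  norm_num

/-- THE OUT-BAND AS PRINTED: `k ∈ shellOut ⟺ 5 ≤ |k| < 9`. -/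
theorem mem_shellOut_iff_sqrt (k : Fin 3 → ℤ) :
    k ∈ shellOut ↔ (5 : ℝ) ≤ Real.sqrt (knormSq k) ∧ Real.sqrt (knormSq k) < 9 := by
  have h := sqrt_mem_Ico_iff (isq k) (a := 5) (b := 9) (by norm_num)
  push_cast at h
  rw [knormSq_eq_cast, h, shellOut, mem_shell_iff (by norm_num)]
  norm_num

/-- THE LEVEL-TWO BAND AS PRINTED: `k ∈ shellOut2i ⟺ 9 ≤ |k| < 17`. -/
theorem mem_shellOut2i_iff_sqrt (k : Fin 3 → ℤ) :
    k ∈ shellOut2i ↔ (9 : ℝ) ≤ Real.sqrt (knormSq k) ∧ Real.sqrt (knormSq k) < 17 := by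
  have h := sqrt_mem_Ico_iff (isq k) (a := 9) (b := 17) (by norm_num)
  push_cast at h
  rw [knormSq_eq_cast, h, shellOut2i, mem_shell_iff (by norm_num)]
  norm_num

/-- THE LEVEL-THREE BAND AS PRINTED: `k ∈ shellOut3i ⟺ 17 ≤ |k| < 33`. -/
theorem mem_shellOut3i_iff_sqrt (k : Fin 3 → ℤ) :
    k ∈ shellOut3i ↔ (17 : ℝ) ≤ Real.sqrt (knormSq k) ∧ Real.sqrt (knormSq k) < 33 := by
  have h := sqrt_mem_Ico_iff (isq k) (a := 17) (b := 33) (by norm_num)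
  push_cast at h
  rw [knormSq_eq_cast, h, shellOut3i, mem_shell_iff (by norm_num)]
  norm_num

/-- The bands are pairwise disjoint and the in-band, guard and out-band tile `7 ≤ |k|² < 81`. -/
theorem shells_disjoint :
    Disjoint shellIn shellMid ∧ Disjoint shellMid shellOut ∧ Disjoint shellIn shellOut ∧
    Disjoint shellOut shellOut2i ∧ Disjoint shellOut2i shellOut3i := by
  simp only [shellIn, shellMid, shellOut, shellOut2i, shellOut3i, Finset.disjoint_left,
    mem_shell_iff (show 21 ≤ (4 + 1) ^ 2 by norm_num), mem_shell_iff (show 25 ≤ (4 + 1) ^ 2 by norm_num),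
    mem_shell_iff (show 81 ≤ (8 + 1) ^ 2 by norm_num), mem_shell_iff (show 289 ≤ (16 + 1) ^ 2 by norm_num),
    mem_shell_iff (show 1089 ≤ (32 + 1) ^ 2 by norm_num)]
  push_cast
  refine ⟨?_, ?_, ?_, ?_, ?_⟩ <;> intro k hk <;> omega

/-! ## 2. The band sup ceiling on the shells -/

/-- A shell with `lo ≥ 1` does not contain the zero mode. -/
theorem shell_ne_zero {K lo hi : ℕ} (hlo : 1 ≤ lo) : ∀ k ∈ shell K lo hi, k ≠ 0 := by
  intro k hk h0
  rw [mem_shell_iff_box] at hk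
  subst h0
  have : isq 0 = 0 := by simp [isq]
  rw [this] at hk
  have := hk.2.1
  omega

/-- `|k|²` is unchanged by a coordinate sign change (integer form of `BandSupCeiling.knormSq_flipAt`). -/
theorem isq_flipAt (i : Fin 3) (k : Fin 3 → ℤ) : isq (flipAt i k) = isq k := by
  have h := knormSq_flipAt i k
  rw [knormSq_eq_cast, knormSq_eq_cast] at h
  exact_mod_cast h

/-- `|k|²` is unchanged by a coordinate exchange (integer form of `BandSupCeiling.knormSq_swapAt`). -/
theorem isq_swapAt (i j : Fin 3) (k : Fin 3 → ℤ) : isq (swapAt i j k) = isq k := by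
  have h := knormSq_swapAt i j k
  rw [knormSq_eq_cast, knormSq_eq_cast] at h
  exact_mod_cast h

/-- Shells are closed under coordinate sign changes. -/
theorem flipAt_mem_shell {K lo hi : ℕ} (hK : hi ≤ (K + 1) ^ 2) (i : Fin 3) :
    ∀ k ∈ shell K lo hi, flipAt i k ∈ shell K lo hi := by
  intro k hk
  rw [mem_shell_iff hK] at hk ⊢
  rwa [isq_flipAt]

/-- Shells are closed under coordinate exchanges. -/
theorem swapAt_mem_shell {K lo hi : ℕ} (hK : hi ≤ (K + 1) ^ 2) (i j : Fin 3) :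
    ∀ k ∈ shell K lo hi, swapAt i j k ∈ shell K lo hi := by
  intro k hk
  rw [mem_shell_iff hK] at hk ⊢
  rwa [isq_swapAt]

/-- THE CEILING ON A SHELL: for a real incompressible Fourier velocity and a shell band `B` with `1 ≤ lo`,
`hi ≤ (K+1)²`: `Σ_j u_{B,j}(x)² ≤ (4/3)·#B·E_B` at every point (`BandSupCeiling.field_real_normSq_le` with its
three hypotheses discharged). -/
theorem ceiling_shell (U : FourierVelocity) {K lo hi : ℕ} (hlo : 1 ≤ lo) (hK : hi ≤ (K + 1) ^ 2)
    (x y z : ℝ) (hreal : ∀ j, (field U (shell K lo hi) j x y z).im = 0) :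
    ∑ j, (field U (shell K lo hi) j x y z).re ^ 2 ≤
      4 / 3 * ((shell K lo hi).card : ℝ) * truncEnergy U (shell K lo hi) :=
  field_real_normSq_le U (shell K lo hi) (shell_ne_zero hlo) (flipAt_mem_shell hK)
    (swapAt_mem_shell hK) x y z hreal

/-- IN-BAND CEILING: `|u_in(x)|² ≤ (4/3)·308·E_in`. -/
theorem ceiling_in (U : FourierVelocity) (x y z : ℝ) (hreal : ∀ j, (field U shellIn j x y z).im = 0) :
    ∑ j, (field U shellIn j x y z).re ^ 2 ≤ 4 / 3 * 308 * truncEnergy U shellIn := by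
  have h := ceiling_shell U (K := 4) (lo := 7) (hi := 21) (by norm_num) (by norm_num) x y z hreal
  rw [← shellIn, card_shellIn] at h
  exact_mod_cast h

/-- OUT-BAND CEILING: `|u_out(x)|² ≤ (4/3)·2484·E_out`. -/
theorem ceiling_out (U : FourierVelocity) (x y z : ℝ) (hreal : ∀ j, (field U shellOut j x y z).im = 0) :
    ∑ j, (field U shellOut j x y z).re ^ 2 ≤ 4 / 3 * 2484 * truncEnergy U shellOut := by
  have h := ceiling_shell U (K := 8) (lo := 25) (hi := 81) (by norm_num) (by norm_num) x y z hreal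
  rw [← shellOut, card_shellOut] at h
  exact_mod_cast h

/-- LEVEL-TWO CEILING: `|u_out2i(x)|² ≤ (4/3)·17408·E_out2i`. -/
theorem ceiling_out2i (U : FourierVelocity) (x y z : ℝ)
    (hreal : ∀ j, (field U shellOut2i j x y z).im = 0) :
    ∑ j, (field U shellOut2i j x y z).re ^ 2 ≤ 4 / 3 * 17408 * truncEnergy U shellOut2i := by
  have h := ceiling_shell U (K := 16) (lo := 81) (hi := 289) (by norm_num) (by norm_num) x y z hreal
  rw [← shellOut2i, card_shellOut2i] at h
  exact_mod_cast h

/-- LEVEL-THREE CEILING: `|u_out3i(x)|² ≤ (4/3)·129788·E_out3i`. -/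
theorem ceiling_out3i (U : FourierVelocity) (x y z : ℝ)
    (hreal : ∀ j, (field U shellOut3i j x y z).im = 0) :
    ∑ j, (field U shellOut3i j x y z).re ^ 2 ≤ 4 / 3 * 129788 * truncEnergy U shellOut3i := by
  have h := ceiling_shell U (K := 32) (lo := 289) (hi := 1089) (by norm_num) (by norm_num) x y z hreal
  rw [← shellOut3i, card_shellOut3i] at h
  exact_mod_cast h

/-- THE LEDGER'S NORMALISATION: under the ceiling `U² ≤ (4/3)·M·E` (with `E, M > 0`) the normalised coherence
`φ² = (U/√(2E))²·(3/(2M))` — the quantity of `CoherenceLedger.q2_mode_normalised` with `M = 308 / 2484 / 17408` —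
is at most `1`. -/
theorem coherenceSq_le_one {U E M : ℝ} (hE : 0 < E) (hM : 0 < M) (h : U ^ 2 ≤ 4 / 3 * M * E) :
    (U / Real.sqrt (2 * E)) ^ 2 * (3 / (2 * M)) ≤ 1 := by
  rw [div_pow, Real.sq_sqrt (by positivity)]
  rw [div_mul_div_comm, div_le_one (by positivity)]
  nlinarith

/-- Record values: with the certified `M`'s, `3/(2M) = 3/616, 3/4968, 3/34816` and the ledger's `φ` column
`0.221 / 0.247 / 0.189` of the u0_b⁽²⁾ row (`CoherenceLedger.q2_mode_normalised`: `φ² = 0.04871 / 0.06112 / 0.03575`)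
indeed lies in `[0, 1]`, far from the single-aligned-mode value `1`. -/
theorem ledger_phi_values :
    (3 : ℝ) / (2 * 308) = 3 / 616 ∧ (3 : ℝ) / (2 * 2484) = 3 / 4968 ∧ (3 : ℝ) / (2 * 17408) = 3 / 34816 ∧
    (0 : ℝ) ≤ 0.04871 ∧ (0.04871 : ℝ) ≤ 1 ∧ (0.06112 : ℝ) ≤ 1 ∧ (0.03575 : ℝ) ≤ 1 := by
  norm_num

end Summit.NavierStokesRegularity.FluidComputer.BandModeCounts
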